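import Literature.AnabelianGeometry.EtaleTheta.SettingModelTateInversion
import Literature.AnabelianGeometry.EtaleTheta.SettingModelTateDoubleUnderline
import Literature.AnabelianGeometry.EtaleTheta.SettingModelTateCusp
import Literature.AnabelianGeometry.EtaleTheta.SettingModelPowHat
import Literature.AnabelianGeometry.EtaleTheta.SettingModel2Theta
import Literature.AnabelianGeometry.EtaleTheta.SettingModelThetaCentreZHat
import Literature.AnabelianGeometry.EtaleTheta.ZHatLevelDetermination
import Literature.AnabelianGeometry.EtaleTheta.CyclotomeZHatAction
import Literature.AnabelianGeometry.AbsoluteAnabelian.ZHatCompletionAdicCompleteness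
import HarnessLib

/-!
# The PROFINITE-INNER automorphisms `Ad(A)|_{Π^tp_X}`, `A ∈ F̂₂`, of the stage-2 Tate model — EXOTIC automorphisms of the
# model's `Π^tp_{X̲̲}` over `G` (proof-only; K-L6 row «HUNIQ-REFUTED-AT-MODEL», file 1)

S. Mochizuki, *Inter-universal Teichmüller theory II*, §1, Rmk. 1.4.1 (ii) (kurims p. 28: «the unique order two
`Δ^tp_{X̲̲_k}`-outer automorphism of `Π^tp_{X̲̲_k}` over `G_k`») [claim: Mochizuki2012, status: disputed]; [EtTh] §1 p. 12,
§2 p. 36, Def. 2.5 (i) p. 39 [cite: MochizukiEtTh2009, §1 p.12]; [SemiAnbd] Lem. 6.1 (i) p. 69 («`N_{F̂}(F) = F`»)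
[cite: MochizukiSemiAnbd2006, Lem 6.1(i) p.69].  Cell `abc-iut`, seat abc-iut-L6-d2 (gen 9), K-L6 row «HUNIQ-REFUTED-AT-MODEL».
PROOF-ONLY: no definition / instance / named fact — the automorphism is delivered as an `∃` with its DEFINING EQUATION, and
every property is proved for ANY automorphism satisfying that equation.

THE NON-GENUINE FEATURE (abc-iut-L6-d6 gen 5 census (b); abc-iut-w5-d187 gen 8 (N)).  In the stage-2 Tate model
`Π^tp_X := Γ ⋊_{(κ_p^i, κ_p^j, χ)} G_{ℚ_p}` (`PiTpχq p i j`), `Γ = ê⁻¹(ι ℤ) ⊆ F̂₂` (`Gfp`), the tempered group is NORMAL in its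
profinite completion `Π_X = F̂₂ ⋊ G_{ℚ_p}` (`PiHtχq`, `toHatχq`): conjugation by `inl A`, ANY `A ∈ F̂₂`, preserves `ê`, hence
`Γ`, hence `Π^tp_X` — whereas print's `Π^tp_X` is its own normaliser in `Π_X`.  RESULTS (every `p i j`; `l` odd):
`exists_profiniteInner` (∃ `φ : Π^tp_X ≃ₜ* Π^tp_X` with `toHat (φ x) = inl A · toHat x · (inl A)⁻¹`) and, for any such `φ`:
`right_eq_of_toHat_eq` (over `G`), `gfpSnd_left_of_toHat_eq` (degree preserved), `map_Huuχq_of_toHat_eq` (`Π^tp_{X̲̲} =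
dUU l ⋊ G` stable once `ĥ_l(A) = 1`, by the odd-level law of the Tate action), `inversionχq_apply_inversionχq_apply_of_toHat_eq`
(`ι φ ι φ = id` when `σ̂ A = A⁻¹`, by `sigmaHat_affTwist₃`), `not_inner_inversionχq_comp_of_toHat_eq` (`ι ∘ φ` reverses the
degree, so it is no `Ad(δ)`), `not_inner_of_toHat_eq` (`φ` is no `Ad(e)` once `ê(A) ∉ ι(ℤ)`: read the conjugate of
`ĥ_N(b) = (0,1,0)` at every Heisenberg level).  The datum `A` with `ĥ_l(A) = 1`, `σ̂ A = A⁻¹`, `ê(A) ∉ ι(ℤ)` is the sibling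
file `ThetaSettingModelTateExoticDatum` (`exists_exoticDatum`).
Consumed BY NAME: abc-iut-w5-d249's `PiTpχq`/`PiHtχq`/`toHatχq`/`actHatχq`/`inversionχq`/`sigmaHat_affTwist₃`, abc-iut-L2-d1's
`Huuχq`/`dUU`/`hHat_actHatχq_of_two_mul_eq_one`, abc-iut-L2's `powHat`, `hHat`, `modN`, `ZHatLevel.ext_of_level`.

HONEST FRAMING: `modelχq` is a SEMI-SYNTHETIC model (binder-discharge / joint-satisfiability evidence for OUR typed interface,
not the tempered `π₁` of a curve); the feature exhibited is a property of THE MODEL, not of print's tempered fundamental group;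
refuted-at-a-model ≠ refuted-in-print; no side taken on [IUTchIII] Cor. 3.12; typed ≠ proved; nothing asserts abc proved or
refuted.
-/

set_option autoImplicit false

noncomputable section

namespace Literature.AnabelianGeometry.EtaleTheta.SettingModel

open Literature.AnabelianGeometry.SemiGraphs
open Literature.AnabelianGeometry.AbsoluteAnabelian (ZHatCompletion.mul_comm)
open Function
open _root_.Topology

variable (p : ℕ) [Fact p.Prime] (i j : ℤ)

/-! ## §1. The profinite-inner automorphism `Ad(A)|_{Π^tp_X}` — existence with its defining equation -/

/-- The `Γ`-membership of the conjugated coordinate: `ê(A · pr₁ γ · (σ·A)⁻¹) = ê(pr₁ γ) = ι(deg γ)` (`ê` is a homomorphism to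
the commutative `Ẑ`, and the Tate action preserves `ê`). [cite: MochizukiEtTh2009, §1 p.12] -/
theorem conj_coord_mem_Gfp (A : F₂hatT) (x : PiTpχq p i j) :
    ((A * gfpFst x.left * (actHatχq p i j x.right A)⁻¹, (x.left : F₂hatT × Multiplicative ℤ).2) :
      F₂hatT × Multiplicative ℤ) ∈ Gfp := by
  rw [mem_Gfp]
  change eHat (A * gfpFst x.left * (actHatχq p i j x.right A)⁻¹) = iotaZ (x.left : F₂hatT × Multiplicative ℤ).2
  rw [map_mul, map_mul, map_inv, eHat_actHatχq, gfpFst_apply, (mem_Gfp _).mp x.left.2,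
    ZHatCompletion.mul_comm (eHat A), mul_inv_cancel_right]

/-- **`Ad(A)|_{Π^tp_X}` EXISTS** for every `A ∈ F̂₂`: a bi-continuous automorphism `φ` of the stage-2 tempered group `Π^tp_X`
whose image in the profinite completion `Π_X = F̂₂ ⋊ G_{ℚ_p}` is conjugation by `inl A` — `toHat (φ x) = inl A · toHat x ·
(inl A)⁻¹` (explicitly `φ ⟨γ, σ⟩ = ⟨(A · pr₁ γ · (σ·A)⁻¹, deg γ), σ⟩`).  The non-genuine feature of the model: `Π^tp_X` is
normalised by all of `F̂₂`. [cite: MochizukiSemiAnbd2006, Lem 6.1(i) p.69] -/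
theorem exists_profiniteInner (A : F₂hatT) :
    ∃ φ : PiTpχq p i j ≃ₜ* PiTpχq p i j,
      ∀ x, toHatχq p i j (φ x) =
        SemidirectProduct.inl A * toHatχq p i j x * (SemidirectProduct.inl A)⁻¹ := by
  classical
  let f : F₂hatT → PiTpχq p i j → PiTpχq p i j := fun B x =>
    ⟨⟨(B * gfpFst x.left * (actHatχq p i j x.right B)⁻¹, (x.left : F₂hatT × Multiplicative ℤ).2),
      conj_coord_mem_Gfp p i j B x⟩, x.right⟩
  have hf : ∀ B x, toHatχq p i j (f B x) =
      SemidirectProduct.inl B * toHatχq p i j x * (SemidirectProduct.inl B)⁻¹ := by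
    intro B x
    refine SemidirectProduct.ext ?_ ?_
    · rw [toHatχq_left, SemidirectProduct.mul_left, SemidirectProduct.mul_left, SemidirectProduct.inv_left,
        SemidirectProduct.left_inl, SemidirectProduct.right_inl, SemidirectProduct.mul_right,
        SemidirectProduct.right_inl, map_one, MulAut.one_apply, one_mul, toHatχq_left, toHatχq_right, inv_one,
        map_one, MulAut.one_apply, map_inv]
      rfl
    · rw [toHatχq_right, SemidirectProduct.mul_right, SemidirectProduct.mul_right, SemidirectProduct.inv_right,
        SemidirectProduct.right_inl, inv_one, mul_one, one_mul, toHatχq_right]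
  have hff : ∀ B x, f (B⁻¹) (f B x) = x := by
    intro B x
    apply toHatχq_injective p i j
    rw [hf, hf, map_inv, inv_inv]
    group
  have hmul : ∀ B x y, f B (x * y) = f B x * f B y := by
    intro B x y
    apply toHatχq_injective p i j
    rw [map_mul, hf, hf, hf, map_mul]
    group
  have hcont : ∀ B, Continuous (f B) := by
    intro B
    rw [(isInducing_leftRightχq p i j).continuous_iff]
    have hl : Continuous fun x : PiTpχq p i j => x.left := continuous_fst.comp (isInducing_leftRightχq p i j).continuous
    have hr : Continuous fun x : PiTpχq p i j => x.right :=
      continuous_snd.comp (isInducing_leftRightχq p i j).continuous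
    change Continuous fun x : PiTpχq p i j => ((f B x).left, (f B x).right)
    refine Continuous.prodMk ?_ hr
    refine Continuous.subtype_mk (Continuous.prodMk ?_ ?_) _
    · exact (continuous_const.mul (gfpFst.continuous.comp hl)).mul
        (((continuous_actHatχq_left p i j B).comp hr).inv)
    · exact continuous_snd.comp (continuous_subtype_val.comp hl)
  let e : PiTpχq p i j ≃* PiTpχq p i j :=
    { toFun := f A
      invFun := f (A⁻¹)
      left_inv := hff A
      right_inv := fun x => by simpa only [inv_inv] using hff (A⁻¹) x
      map_mul' := hmul A }
  exact ⟨{ e with continuous_toFun := hcont A, continuous_invFun := hcont (A⁻¹) }, hf A⟩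

/-- `toHat (inl γ) = inl (pr₁ γ)`. [cite: MochizukiEtTh2009, §1 p.12] -/
theorem toHatχq_inl_eq (γ : Gfp) :
    toHatχq p i j (SemidirectProduct.inl γ) = SemidirectProduct.inl (gfpFst γ) :=
  SemidirectProduct.ext (by rw [toHatχq_left, SemidirectProduct.left_inl, SemidirectProduct.left_inl])
    (by rw [toHatχq_right, SemidirectProduct.right_inl, SemidirectProduct.right_inl])

/-! ## §2. Properties of any `φ` with `toHat ∘ φ = Ad(inl A) ∘ toHat` -/

section Props

variable {p i j} {A : F₂hatT} {φ : PiTpχq p i j ≃ₜ* PiTpχq p i j}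
  (hφ : ∀ x, toHatχq p i j (φ x) = SemidirectProduct.inl A * toHatχq p i j x * (SemidirectProduct.inl A)⁻¹)
include hφ

/-- `Ad(A)|_{Π^tp_X}` is OVER `G_{ℚ_p}`: `(φ x).right = x.right`. [cite: MochizukiEtTh2009, §1 p.12] -/
theorem right_eq_of_toHat_eq (x : PiTpχq p i j) : (φ x).right = x.right := by
  have h := congrArg SemidirectProduct.right (hφ x)
  rw [toHatχq_right, SemidirectProduct.mul_right, SemidirectProduct.mul_right, SemidirectProduct.inv_right,
    SemidirectProduct.right_inl, inv_one, mul_one, one_mul, toHatχq_right] at h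
  exact h

/-- The `F̂₂`-coordinate: `pr₁ (φ x).left = A · pr₁ x.left · (x.right·A)⁻¹`. [cite: MochizukiEtTh2009, §1 p.12] -/
theorem gfpFst_left_of_toHat_eq (x : PiTpχq p i j) :
    gfpFst (φ x).left = A * gfpFst x.left * (actHatχq p i j x.right A)⁻¹ := by
  have h := congrArg SemidirectProduct.left (hφ x)
  rw [toHatχq_left, SemidirectProduct.mul_left, SemidirectProduct.mul_left, SemidirectProduct.inv_left,
    SemidirectProduct.left_inl, SemidirectProduct.right_inl, SemidirectProduct.mul_right,
    SemidirectProduct.right_inl, map_one, MulAut.one_apply, one_mul, toHatχq_left, toHatχq_right, inv_one,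
    map_one, MulAut.one_apply, map_inv] at h
  exact h

/-- `Ad(A)|_{Π^tp_X}` preserves the DEGREE `Γ ↠ ℤ`: `deg (φ x).left = deg x.left` (`ê` of the conjugated coordinate is
unchanged and `ι` is injective). [cite: MochizukiEtTh2009, §1 p.12] -/
theorem gfpSnd_left_of_toHat_eq (x : PiTpχq p i j) : gfpSnd (φ x).left = gfpSnd x.left := by
  apply iotaZ_injective
  rw [gfpSnd_apply, gfpSnd_apply, ← (mem_Gfp _).mp (φ x).left.2, ← (mem_Gfp _).mp x.left.2, ← gfpFst_apply,
    ← gfpFst_apply, gfpFst_left_of_toHat_eq hφ, map_mul, map_mul, map_inv, eHat_actHatχq,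
    ZHatCompletion.mul_comm (eHat A), mul_inv_cancel_right]

/-- **At ODD level `N` with `ĥ_N(A) = 1`, `φ` does not move the Heisenberg coordinates**: `ĥ_N(pr₁ (φ x).left) =
ĥ_N(pr₁ x.left)` (the Tate action has an honest level law `tateLevelHom` at odd level, a homomorphism, so `ĥ_N(σ·A) = 1`
too). [cite: MochizukiEtTh2009, Def 2.5 (i) p.39] -/
theorem levelHom_left_of_toHat_eq (N : ℕ+) (hN : Odd (N : ℕ)) (hA : hHat N A = 1) (x : PiTpχq p i j) :
    levelHom N (φ x).left = levelHom N x.left := by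
  obtain ⟨e, he⟩ := exists_two_mul_eq_one_of_odd N hN
  change hHat N (gfpFst (φ x).left) = hHat N (gfpFst x.left)
  rw [gfpFst_left_of_toHat_eq hφ, map_mul, map_mul, map_inv, hA, one_mul,
    hHat_actHatχq_of_two_mul_eq_one p i j N he, hA, map_one, inv_one, mul_one]

/-- **`Ad(A)|_{Π^tp_X}` STABILISES `Π^tp_{X̲̲} = dUU l ⋊ G_{ℚ_p}`** (`l` odd) as soon as `ĥ_l(A) = 1` (membership is read on
the level-`l` coordinates `x = 0`, `z = 0`, which `φ` does not move). [cite: MochizukiEtTh2009, Def 2.5 (i) p.39] -/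
theorem map_Huuχq_of_toHat_eq (l : ℕ+) (hl : Odd (l : ℕ)) (hA : hHat l A = 1) :
    (Huuχq p i j l hl).map φ.toMulEquiv.toMonoidHom = Huuχq p i j l hl := by
  have key : ∀ x, φ x ∈ Huuχq p i j l hl ↔ x ∈ Huuχq p i j l hl := fun x => by
    rw [mem_Huuχq_iff, mem_Huuχq_iff, levelHom_left_of_toHat_eq hφ l hl hA]
  ext x
  constructor
  · rintro ⟨y, hy, rfl⟩
    exact (key y).2 hy
  · intro hx
    exact ⟨φ.symm x, (key _).1 (by simpa using hx), φ.apply_symm_apply x⟩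

/-- **`(ι ∘ φ)² = id` when `σ̂ A = A⁻¹`**, `ι := inversionχq` the stage-2 inversion: by abc-iut-w5-d249's
`sigmaHat_affTwist₃` (`σ̂ (σ·A) = Inn(b^{d σ}) (σ·σ̂A)`) the two defect `b`-powers cancel.  So `ι ∘ φ|_{Π^tp_{X̲̲}}` is an
automorphism of EXACT order two. [cite: MochizukiEtTh2009, §2 p.36] -/
theorem inversionχq_apply_inversionχq_apply_of_toHat_eq (hσA : sigmaHat A = A⁻¹) (x : PiTpχq p i j) :
    inversionχq p i j (φ (inversionχq p i j (φ x))) = x := by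
  have hR : ∀ y : PiTpχq p i j, (inversionχq p i j y).right = y.right := fun y => rfl
  have hL : ∀ y : PiTpχq p i j, gfpFst (inversionχq p i j y).left =
      sigmaHat (gfpFst y.left) * bPow (invDefect (tatePairHom p i j y.right)) := fun y => by
    rw [inversionχq_apply, tateInversion_left, map_mul, gfpFst_bPowGfp, gfpFst_apply, coe_gfpInv]
    rfl
  refine SemidirectProduct.ext (gfpFst_injective ?_) ?_
  · -- `F̂₂`-coordinates
    rw [hL, gfpFst_left_of_toHat_eq hφ, right_eq_of_toHat_eq hφ, hR, hL, gfpFst_left_of_toHat_eq hφ,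
      right_eq_of_toHat_eq hφ]
    set σ := x.right
    set d := invDefect (tatePairHom p i j σ)
    set g := gfpFst x.left
    have hact : actHatχq p i j σ A = affTwist₃ (tatePairHom p i j σ) A := rfl
    have h1 : sigmaHat (actHatχq p i j σ A) = bPow d * (actHatχq p i j σ A)⁻¹ * (bPow d)⁻¹ := by
      rw [hact, sigmaHat_affTwist₃, innB_apply, hσA, map_inv]
    simp only [map_mul, map_inv, sigmaHat_sigmaHat, hσA, sigmaHat_bPow, inv_inv]
    rw [h1]
    group
  · rw [hR, right_eq_of_toHat_eq hφ, hR, right_eq_of_toHat_eq hφ]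

variable (p i j)

/-- **`ι ∘ φ` is NOT `Ad(δ)` on `Π^tp_{X̲̲}` for ANY `δ ∈ Π^tp_{X̲̲}`** (indeed for any `δ ∈ Π^tp_X`): `ι ∘ φ` REVERSES the degree
`Π^tp_X ↠ Γ ↠ ℤ` while inner automorphisms preserve it, and `Π^tp_{X̲̲}` contains `inl (η(a^l), l)` of degree `l ≠ 0`.
[claim: Mochizuki2012, status: disputed] (IUTchII §1 Rmk 1.4.1 (ii), kurims p.28) -/
theorem not_inner_inversionχq_comp_of_toHat_eq (l : ℕ+) (hl : Odd (l : ℕ)) (δ : PiTpχq p i j) :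
    ¬ ∀ h ∈ Huuχq p i j l hl, inversionχq p i j (φ h) = δ * h * δ⁻¹ := by
  intro hall
  -- powers of the generator `(1,0,0)` of the Heisenberg group: `(1,0,0)^n = (n,0,0)`
  have hpow : ∀ {R : Type} [CommRing R] (n : ℕ), ((⟨1, 0, 0⟩ : Heis R) ^ n) = ⟨(n : R), 0, 0⟩ := by
    intro R _ n
    induction n with
    | zero => ext <;> simp
    | succ n ih => rw [pow_succ, ih]; ext <;> simp
  -- the element `inl (η(a^l), l) ∈ Π^tp_{X̲̲}` of degree `l`
  have hmem : ((eta (FreeGroup.of 0 ^ (l : ℕ)), Multiplicative.ofAdd ((l : ℕ) : ℤ)) : F₂hatT × Multiplicative ℤ) ∈ Gfp := by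
    rw [mem_Gfp]
    change eHat (eta (FreeGroup.of 0 ^ (l : ℕ))) = iotaZ (Multiplicative.ofAdd ((l : ℕ) : ℤ))
    rw [eHat_eta, expA_apply, map_pow, heisHom_of_zero, hpow]
  let γ₀ : Gfp := ⟨_, hmem⟩
  have hx : hHat l (eta (FreeGroup.of 0 ^ (l : ℕ))) = ⟨((l : ℕ) : ZMod l), 0, 0⟩ := by
    rw [hHat_eta, map_pow, heisHom_of_zero, hpow]
    ext <;> simp
  have hγ₀ : (SemidirectProduct.inl γ₀ : PiTpχq p i j) ∈ Huuχq p i j l hl := by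
    rw [inl_mem_Huuχq_iff, mem_dUU_iff]
    change (hHat l (eta (FreeGroup.of 0 ^ (l : ℕ)))).x = 0 ∧ (hHat l (eta (FreeGroup.of 0 ^ (l : ℕ)))).z = 0
    rw [hx]
    exact ⟨ZMod.natCast_self _, rfl⟩
  have h := hall _ hγ₀
  -- degrees: the left-hand side has degree `−l`, the right-hand side degree `l`
  have hdeg : gfpSnd (inversionχq p i j (φ (SemidirectProduct.inl γ₀))).left =
      gfpSnd (δ * SemidirectProduct.inl γ₀ * δ⁻¹).left := congrArg (fun y : PiTpχq p i j => gfpSnd y.left) h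
  rw [gfpSnd_left_inversionχq, gfpSnd_left_of_toHat_eq hφ, SemidirectProduct.left_inl] at hdeg
  have hR : gfpSnd (δ * SemidirectProduct.inl γ₀ * δ⁻¹).left = gfpSnd γ₀ := by
    change (tateTwistData₀ p i j).toZ (δ * SemidirectProduct.inl γ₀ * δ⁻¹) = gfpSnd γ₀
    rw [map_mul, map_mul, map_inv, mul_inv_cancel_comm, GfpTwistData₀.toZ_apply, SemidirectProduct.left_inl]
  rw [hR] at hdeg
  change (Multiplicative.ofAdd ((l : ℕ) : ℤ))⁻¹ = Multiplicative.ofAdd ((l : ℕ) : ℤ) at hdeg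
  rw [← ofAdd_neg, Multiplicative.ofAdd.injective.eq_iff, neg_eq_iff_add_eq_zero] at hdeg
  have : ((l : ℕ) : ℤ) = 0 := by linarith
  exact PNat.ne_zero l (by exact_mod_cast this)


/-- **`φ = Ad(A)|_{Π^tp_X}` is NOT `Ad(e)` on `Π^tp_{X̲̲}` for ANY `e ∈ Π^tp_X` once `ê(A) ∉ ι(ℤ)`.**  Evaluate on
`inl (b, 0) ∈ Π^tp_{X̲̲}` and read the conjugate `(0, 1, x)` of `ĥ_N(b) = (0, 1, 0)` at every Heisenberg level `N`: its
`z`-coordinate is the `x`-coordinate of the conjugator, i.e. `ê` mod `N`; so `ê(A) ≡ ê(pr₁ e.left) (mod N)` for all `N`,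
whence `ê(A) = ι(deg e.left) ∈ ι(ℤ)`. [claim: Mochizuki2012, status: disputed] (IUTchII §1 Rmk 1.4.1 (ii), kurims p.28) -/
theorem not_inner_of_toHat_eq (l : ℕ+) (hl : Odd (l : ℕ)) (hA' : ∀ k : Multiplicative ℤ, eHat A ≠ iotaZ k)
    (e : PiTpχq p i j) : ¬ ∀ h ∈ Huuχq p i j l hl, φ h = e * h * e⁻¹ := by
  intro hall
  -- conjugation in the Heisenberg group moves `(0, y, 0)` to `(0, y, x·y)`
  have hconj : ∀ {R : Type} [CommRing R] (c : Heis R) (y : R), c * ⟨0, y, 0⟩ * c⁻¹ = ⟨0, y, c.x * y⟩ := by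
    intro R _ c y
    ext
    · simp
    · simp
    · simp; ring
  -- the element `inl (b, 0) ∈ Π^tp_{X̲̲}`
  set t₁ : ZH := iotaZ (Multiplicative.ofAdd 1) with ht₁
  have hβ : (SemidirectProduct.inl (bPowGfp t₁) : PiTpχq p i j) ∈ Huuχq p i j l hl := by
    rw [inl_mem_Huuχq_iff, mem_dUU_iff]
    change (hHat l (gfpFst (bPowGfp t₁))).x = 0 ∧ (hHat l (gfpFst (bPowGfp t₁))).z = 0
    rw [gfpFst_bPowGfp, hHat_bPow]
    exact ⟨rfl, rfl⟩
  -- the two sides in `F̂₂`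
  have hL : (toHatχq p i j (φ (SemidirectProduct.inl (bPowGfp t₁)))).left = A * bPow t₁ * A⁻¹ := by
    rw [toHatχq_left, gfpFst_left_of_toHat_eq hφ, SemidirectProduct.left_inl, SemidirectProduct.right_inl,
      map_one (actHatχq p i j), MulAut.one_apply, gfpFst_bPowGfp]
  have hR : (toHatχq p i j (e * SemidirectProduct.inl (bPowGfp t₁) * e⁻¹)).left =
      gfpFst e.left * bPow ((tatePairHom p i j e.right).right t₁) * (gfpFst e.left)⁻¹ := by
    rw [map_mul, map_mul, map_inv, toHatχq_inl_eq, gfpFst_bPowGfp, SemidirectProduct.mul_left,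
      SemidirectProduct.mul_left, SemidirectProduct.left_inl, SemidirectProduct.mul_right, SemidirectProduct.right_inl,
      mul_one, SemidirectProduct.inv_left, ← MulAut.mul_apply, ← map_mul (actHatχq p i j), mul_inv_cancel,
      map_one (actHatχq p i j), MulAut.one_apply, actHatχq_bPow, toHatχq_left, toHatχq_right]
  have h : A * bPow t₁ * A⁻¹ = gfpFst e.left * bPow ((tatePairHom p i j e.right).right t₁) * (gfpFst e.left)⁻¹ := by
    rw [← hL, ← hR, hall _ hβ]
  -- `h : A * b * A⁻¹ = pr₁ e.left * b^{r 1} * (pr₁ e.left)⁻¹`; read it at every Heisenberg level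
  have hx : ∀ N : ℕ+, (hHat N A).x = (hHat N (gfpFst e.left)).x := by
    intro N
    have hN := congrArg (hHat N) h
    rw [map_mul, map_mul, map_inv, hHat_bPow, hconj, map_mul, map_mul, map_inv, hHat_bPow, hconj] at hN
    have hy := congrArg Heis.y hN
    have hz := congrArg Heis.z hN
    simp only at hy hz
    rw [← hy] at hz
    have h1 : Multiplicative.toAdd (ZHatLevel.level N t₁) = 1 := by
      rw [ht₁]
      change Multiplicative.toAdd (ZHatLevel.level N (ZHatLevel.eta 1)) = 1
      rw [ZHatLevel.level_eta, toAdd_ofAdd, Int.cast_one]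
    rw [h1, mul_one, mul_one] at hz
    exact hz
  -- hence `ê(A) = ê(pr₁ e.left) = ι(deg e.left)`
  have hE : eHat A = eHat (gfpFst e.left) := by
    refine ZHatLevel.ext_of_level fun N => ?_
    rw [← modN_eq_level, ← modN_eq_level, ← hHat_x_eq_modN_eHat, ← hHat_x_eq_modN_eHat, hx N]
  rw [gfpFst_apply, (mem_Gfp _).mp e.left.2] at hE
  exact hA' _ hE

end Props

end Literature.AnabelianGeometry.EtaleTheta.SettingModel

end
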